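import Summits.Ventures.HSemireg.WedgeHankelRecurrenceGaussChebyshevTFixedPointIdealAllRings

/-!
# Venture HSemireg — **THE `−1`-LEVEL IDEAL OF `T`: `(T_m + 1, T_n + 1) = (T_{gcd(m,n)} + 1)` IF `m ∕ gcd`, `n ∕ gcd` ARE BOTH ODD, AND `= (2, T_{gcd(m,n)} + 1)` OTHERWISE — AS IDEALS OF `R[X]` FOR EVERY
# COMMUTATIVE RING `R`** (the points with `T_m = −1`, i.e. `x = −1` and the double third-kind ∕ Radau points of N478, against those with `T_n = −1`): push N491 ∕ N494 `(C_m + 2, C_n + 2) = (C_g + 2)`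
# resp. `(4, C_g + 2)` along `X ↦ 2X` (`C_k(2X) + 2 = 2(T_k + 1)`), cancel the non-zero-divisor `2` over `ℤ`, and base-change `ℤ[X] → R[X]`; integer reading **`gcd(T_m(a) + 1, T_n(a) + 1) =
# |T_g(a) + 1|` resp. `gcd(2, T_g(a) + 1)`**

HONEST FRAMING. Part of the Lean index of the computation cell `pub-hsemireg` (seat p10 gen 48, Sunday typer «UNIFORM-IN-n»).  Polynomial ideal algebra only; no variety, no cohomology theory, no sheaf,
no Ext group and no semiregularity map is constructed here; nothing here says that HC / HC_CM / HC_AV holds; no Literature fact (unproved `Prop`) is declared or used.  Custodian versions as in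
`WedgeHankelSiegelIdeal` (1/3).
SOURCES (cited).  T. J. Rivlin, *Chebyshev Polynomials* (1990), §1.2, Ch. 4; J. C. Mason, D. C. Handscomb, *Chebyshev Polynomials* (2003), §1.2.3 (third-kind zeros); W. L. McDaniel, Fibonacci Quart. 29
(1991) 24–29.
PROOF TYPED HERE.  N491 `chebyshevC_add_two_span_pair`, N494 `chebyshevC_add_two_span_pair_mixed`; N495 `span_pair_eq_span_singleton_of_mul_left`; N476 `int_gcd_eq_natAbs_of_span_pair_eq`,
`int_gcd_eq_of_span_pair_eq`; Mathlib `Polynomial.compRingHom`, `C_comp_two_mul_X`, `Polynomial.mapRingHom`, `map_T`, `Ideal.map_span`, `Ideal.mem_span_pair`, `mul_left_cancel₀`.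
DEDUP DISCLOSURE (`rg -n 'span_pair_eq_span_pair_of_mul_left|chebyshevT_add_one_span_pair|chebyshevT_int_eval_add_one_gcd' Summits Literature HarnessLib`, 2026-09-04): N490 ∕ N495 (the `−1 ↦ +1`… i.e. the
`T = 1` level), N478 (one index); 0 hits for the 6 names below.

WHAT IS IN THE TREE.  N476, N478, N491, N494, N495.
THIS FILE (namespace `Summit.Ventures.HSemireg.Wedge.HankelOuter` continued; CHAINED on N495; 0 definitions):
* §1261 `span_pair_eq_span_pair_of_mul_left`, `chebyshevT_two_mul_add_one_span_pair_int`, **`chebyshevT_add_one_span_pair`** (odd ∕ odd, every ring), **`chebyshevT_add_one_span_pair_mixed`** (every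
  ring), **`chebyshevT_int_eval_add_one_gcd`**, **`chebyshevT_int_eval_add_one_gcd_mixed`**.
CAVEATS.  Nothing Ext-side.  New names only.
-/

open Module Polynomial
open scoped Matrix Polynomial

namespace Summit.Ventures.HSemireg.Wedge.HankelOuter

/-! ## §1261. `(T_m + 1, T_n + 1)` in every `R[X]` -/

/-- If `d ≠ 0` in a domain and `(d a, d b) = (d c, d e)`, then `(a, b) = (c, e)`. [bookkeeping; this file, §1261] -/
theorem span_pair_eq_span_pair_of_mul_left {A : Type*} [CommRing A] [IsDomain A] {d : A} (hd : d ≠ 0) {a b c e : A}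
    (h : Ideal.span {d * a, d * b} = Ideal.span {d * c, d * e}) : Ideal.span {a, b} = Ideal.span {c, e} := by
  have key : ∀ {a b c e : A}, Ideal.span {d * a, d * b} ≤ Ideal.span {d * c, d * e} → Ideal.span {a, b} ≤ Ideal.span {c, e} := by
    intro a b c e hle
    rw [Ideal.span_le, Set.insert_subset_iff, Set.singleton_subset_iff, SetLike.mem_coe, SetLike.mem_coe, Ideal.mem_span_pair, Ideal.mem_span_pair]
    have ha : d * a ∈ Ideal.span {d * c, d * e} := hle (Ideal.subset_span (Set.mem_insert _ _))
    have hb : d * b ∈ Ideal.span {d * c, d * e} := hle (Ideal.subset_span (Set.mem_insert_of_mem _ (Set.mem_singleton _)))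
    obtain ⟨α, β, hαβ⟩ := Ideal.mem_span_pair.1 ha
    obtain ⟨γ, δ, hγδ⟩ := Ideal.mem_span_pair.1 hb
    exact ⟨⟨α, β, mul_left_cancel₀ hd (by linear_combination hαβ)⟩, ⟨γ, δ, mul_left_cancel₀ hd (by linear_combination hγδ)⟩⟩
  exact le_antisymm (key h.le) (key h.ge)

/-- Over `ℤ`: `(2(T_m + 1), 2(T_n + 1))` is `(2(T_g + 1))` in the odd ∕ odd case and `(4, 2(T_g + 1))` otherwise (N491 ∕ N494 along `X ↦ 2X`). [this file, §1261] -/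
theorem chebyshevT_two_mul_add_one_span_pair_int (m n : ℕ) :
    (Odd (m / Nat.gcd m n) ∧ Odd (n / Nat.gcd m n) →
      Ideal.span {2 * (Polynomial.Chebyshev.T ℤ (m : ℤ) + 1), 2 * (Polynomial.Chebyshev.T ℤ (n : ℤ) + 1)} = Ideal.span {2 * (Polynomial.Chebyshev.T ℤ (Nat.gcd m n : ℤ) + 1)}) ∧
    (¬ (Odd (m / Nat.gcd m n) ∧ Odd (n / Nat.gcd m n)) →
      Ideal.span {2 * (Polynomial.Chebyshev.T ℤ (m : ℤ) + 1), 2 * (Polynomial.Chebyshev.T ℤ (n : ℤ) + 1)} = Ideal.span {2 * 2, 2 * (Polynomial.Chebyshev.T ℤ (Nat.gcd m n : ℤ) + 1)}) := by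
  have hc : ∀ k : ℤ, Polynomial.compRingHom (2 * Polynomial.X) (Polynomial.Chebyshev.C ℤ k + 2) = 2 * (Polynomial.Chebyshev.T ℤ k + 1) := fun k => by
    rw [Polynomial.coe_compRingHom_apply, add_comp, Polynomial.Chebyshev.C_comp_two_mul_X, ofNat_comp]; simp only [Nat.cast_ofNat]; ring
  have h4 : Polynomial.compRingHom (2 * Polynomial.X) (4 : ℤ[X]) = 2 * 2 := by rw [map_ofNat]; norm_num
  constructor
  · rintro ⟨hm, hn⟩
    have h := congrArg (Ideal.map (Polynomial.compRingHom (2 * Polynomial.X : ℤ[X]))) (chebyshevC_add_two_span_pair (R := ℤ) hm hn)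
    rwa [Ideal.map_span, Ideal.map_span, Set.image_pair, Set.image_singleton, hc, hc, hc] at h
  · intro hmn
    have h := congrArg (Ideal.map (Polynomial.compRingHom (2 * Polynomial.X : ℤ[X]))) (chebyshevC_add_two_span_pair_mixed (R := ℤ) hmn)
    rwa [Ideal.map_span, Ideal.map_span, Set.image_pair, Set.image_pair, hc, hc, hc, h4] at h

/-- **`(T_m + 1, T_n + 1) = (T_{gcd(m,n)} + 1)` in `R[X]` for every commutative ring `R`, when `m ∕ gcd`, `n ∕ gcd` are both odd.** [Rivlin §1.2; this file, §1261] -/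
theorem chebyshevT_add_one_span_pair {R : Type*} [CommRing R] {m n : ℕ} (hm : Odd (m / Nat.gcd m n)) (hn : Odd (n / Nat.gcd m n)) :
    Ideal.span {Polynomial.Chebyshev.T R (m : ℤ) + 1, Polynomial.Chebyshev.T R (n : ℤ) + 1} = Ideal.span {Polynomial.Chebyshev.T R (Nat.gcd m n : ℤ) + 1} := by
  have hZ := span_pair_eq_span_singleton_of_mul_left (two_ne_zero : (2 : ℤ[X]) ≠ 0) ((chebyshevT_two_mul_add_one_span_pair_int m n).1 ⟨hm, hn⟩)
  have h := congrArg (Ideal.map (Polynomial.mapRingHom (Int.castRingHom R))) hZ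
  rwa [Ideal.map_span, Ideal.map_span, Set.image_pair, Set.image_singleton, map_add, map_add, map_add, map_one, Polynomial.coe_mapRingHom, Polynomial.Chebyshev.map_T,
    Polynomial.Chebyshev.map_T, Polynomial.Chebyshev.map_T] at h

/-- **`(T_m + 1, T_n + 1) = (2, T_{gcd(m,n)} + 1)` in `R[X]` for every commutative ring `R`, when `m ∕ gcd`, `n ∕ gcd` are not both odd.** [this file, §1261] -/
theorem chebyshevT_add_one_span_pair_mixed {R : Type*} [CommRing R] {m n : ℕ} (hmn : ¬ (Odd (m / Nat.gcd m n) ∧ Odd (n / Nat.gcd m n))) :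
    Ideal.span {Polynomial.Chebyshev.T R (m : ℤ) + 1, Polynomial.Chebyshev.T R (n : ℤ) + 1} = Ideal.span {2, Polynomial.Chebyshev.T R (Nat.gcd m n : ℤ) + 1} := by
  have hZ := span_pair_eq_span_pair_of_mul_left (two_ne_zero : (2 : ℤ[X]) ≠ 0) ((chebyshevT_two_mul_add_one_span_pair_int m n).2 hmn)
  have h := congrArg (Ideal.map (Polynomial.mapRingHom (Int.castRingHom R))) hZ
  rwa [Ideal.map_span, Ideal.map_span, Set.image_pair, Set.image_pair, map_add, map_add, map_add, map_one, map_ofNat, Polynomial.coe_mapRingHom, Polynomial.Chebyshev.map_T,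
    Polynomial.Chebyshev.map_T, Polynomial.Chebyshev.map_T] at h

/-- **`gcd(T_m(a) + 1, T_n(a) + 1) = |T_{gcd(m,n)}(a) + 1|`** for every integer `a`, when `m ∕ gcd`, `n ∕ gcd` are both odd. [this file, §1261] -/
theorem chebyshevT_int_eval_add_one_gcd (a : ℤ) {m n : ℕ} (hm : Odd (m / Nat.gcd m n)) (hn : Odd (n / Nat.gcd m n)) :
    Int.gcd ((Polynomial.Chebyshev.T ℤ (m : ℤ)).eval a + 1) ((Polynomial.Chebyshev.T ℤ (n : ℤ)).eval a + 1) = ((Polynomial.Chebyshev.T ℤ (Nat.gcd m n : ℤ)).eval a + 1).natAbs := by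
  have hev : ∀ k : ℕ, Polynomial.evalRingHom a (Polynomial.Chebyshev.T ℤ (k : ℤ) + 1) = (Polynomial.Chebyshev.T ℤ (k : ℤ)).eval a + 1 := fun k => by
    rw [map_add, map_one, Polynomial.coe_evalRingHom]
  have h := congrArg (Ideal.map (Polynomial.evalRingHom a)) (chebyshevT_add_one_span_pair (R := ℤ) hm hn)
  rw [Ideal.map_span, Ideal.map_span, Set.image_pair, Set.image_singleton, hev, hev, hev] at h
  exact int_gcd_eq_natAbs_of_span_pair_eq h

/-- **`gcd(T_m(a) + 1, T_n(a) + 1) = gcd(2, T_{gcd(m,n)}(a) + 1)`** for every integer `a`, when `m ∕ gcd`, `n ∕ gcd` are not both odd. [this file, §1261] -/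
theorem chebyshevT_int_eval_add_one_gcd_mixed (a : ℤ) {m n : ℕ} (hmn : ¬ (Odd (m / Nat.gcd m n) ∧ Odd (n / Nat.gcd m n))) :
    Int.gcd ((Polynomial.Chebyshev.T ℤ (m : ℤ)).eval a + 1) ((Polynomial.Chebyshev.T ℤ (n : ℤ)).eval a + 1) = Int.gcd 2 ((Polynomial.Chebyshev.T ℤ (Nat.gcd m n : ℤ)).eval a + 1) := by
  have hev : ∀ k : ℕ, Polynomial.evalRingHom a (Polynomial.Chebyshev.T ℤ (k : ℤ) + 1) = (Polynomial.Chebyshev.T ℤ (k : ℤ)).eval a + 1 := fun k => by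
    rw [map_add, map_one, Polynomial.coe_evalRingHom]
  have h := congrArg (Ideal.map (Polynomial.evalRingHom a)) (chebyshevT_add_one_span_pair_mixed (R := ℤ) hmn)
  rw [Ideal.map_span, Ideal.map_span, Set.image_pair, Set.image_pair, hev, hev, hev, map_ofNat] at h
  exact int_gcd_eq_of_span_pair_eq h

end Summit.Ventures.HSemireg.Wedge.HankelOuter
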